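import Summits.RiemannHypothesis.RiemannHypothesis.Theorems.PfPersistenceBarrierTwinsDials
import Summits.RiemannHypothesis.RiemannHypothesis.Theorems.PfPersistenceLocalityBarrier
import HarnessLib

/-!
# PF persistence, fake seat 1 — Beurling generalized primes: TYPED TARGETS (statements only)

Unit `pub-rhpf-fake-1` of the `pub-rhpf` cell (mechanism / rigidity campaign; **no RH claims**).
Companion of `HOME/FAKES.md §1`.  This file types, over the tree's two data layers, the objects and
claims of §1 so that adjudicators / the typer have exact kernel targets.  NOTHING HERE IS PROVED IN
THE KERNEL except the trivial structural lemmas at the end; every `def … : Prop` carries its label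
(THEOREM-paper / CONJ / DATA) in the docstring.

* Integer layer (`PfPersistence.Weights = ℕ → ℝ`, sub-family B2 = integer edits): an INTEGER
  g-PRIME SYSTEM is a multiplicity function `m : ℕ → ℕ` (`m g` = multiplicity of `g ≥ 2` as a
  g-prime; `ζ` is `primeIndicator`); its weight table is `gTable m n = Λ_m(n) n^{-1/2}` with
  `Λ_m(n) = Σ_{g^k = n, k ≥ 1} m(g) log g`.
* Continuum layer (`PfPersistenceBarrier.ExplicitDatum`, sub-family B1 = discrete DMV twins with real
  g-primes): `beurlingDatum g m` = `ζ`'s smooth part + masses `m_i log gᵢ · gᵢ^{-(k+1)/2}` at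
  `± (k+1) log gᵢ`.

LANDING NOTE (barrier-prover g2, lander per lead §I.5/§I.7 with fake-1 idle since 11:52Z; source
`HOME/lean/PFPersistence/F1Beurling.lean` sha16 8f8f6ed2373ba76d, fake-1): text verbatim except that the
`[folklore]` / `[cite …]` tag is removed from the docstrings of the nine CLOSED `def … : Prop` targets (a tagged closed
`Prop` is auto-relocated to `Literature/Uncategorized` by the gate; these are cell-internal typed targets,
not Literature facts).  Mechanism / rigidity campaign; no RH claims.
-/

set_option linter.dupNamespace false

noncomputable section

open Real Set Matrix

namespace Summit.RiemannHypothesis.RiemannHypothesis.Theorems.PfPersistence.Fake1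

open Summit.RiemannHypothesis.RiemannHypothesis.Theorems.PfPersistence
open Summit.RiemannHypothesis.RiemannHypothesis.Theorems.PfPersistenceBarrier

/-- The continuum explicit-formula datum of `ζ` (`PfPersistenceBarrier.zetaDatum`; the integer-layer
`PfPersistence.zetaDatum : Datum` keeps its short name in this namespace). [folklore] -/
abbrev zetaC : ExplicitDatum := Summit.RiemannHypothesis.RiemannHypothesis.Theorems.PfPersistenceBarrier.zetaDatum

/-! ## §1 Integer g-prime systems (sub-family B2) -/

/-- `ζ`'s multiplicity function: every rational prime once. [folklore] -/
def primeIndicator : ℕ → ℕ := fun g => if g.Prime then 1 else 0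

/-- Generalised von Mangoldt function of the integer g-prime system `m`:
`Λ_m(n) = Σ_{2 ≤ g ≤ n} Σ_{1 ≤ k ≤ n} [g^k = n] m(g) log g`. [folklore] -/
def gMangoldt (m : ℕ → ℕ) (n : ℕ) : ℝ :=
  ∑ g ∈ Finset.Icc 2 n, ∑ k ∈ Finset.Icc 1 n, if g ^ k = n then (m g : ℝ) * Real.log g else 0

/-- Weight table of the integer g-prime system `m` with `ζ`'s dressing: `Λ_m(n) n^{-1/2}` at `log n`
(FAKES.md §1.0 dictionary; generator `controls/fake1_systems.py intedit`). [folklore] -/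
def gTable (m : ℕ → ℕ) : Weights := fun n => gMangoldt m n * (n : ℝ) ^ (-(1 / 2 : ℝ))

/-- `n₁` is the FIRST DISCREPANCY of `m` with the primes. [folklore] -/
def IsFirstDiscrepancy (m : ℕ → ℕ) (n₁ : ℕ) : Prop :=
  2 ≤ n₁ ∧ m n₁ ≠ primeIndicator n₁ ∧ ∀ n, 2 ≤ n → n < n₁ → m n = primeIndicator n

/-- `m` is a FINITE edit of the primes. [folklore] -/
def IsFiniteEdit (m : ℕ → ℕ) : Prop := {n | m n ≠ primeIndicator n}.Finite

/-- TARGET (kernel: routine — `Λ` identification). `gTable primeIndicator = zetaWeights`. (A `Prop`: statement only, label as stated above; not a Literature fact.) -/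
def GTablePrimes : Prop := gTable primeIndicator = zetaWeights

/-- TARGET = RECORD IDENTITY / DEPTH `D(P) = ½ log n₁` (FAKES §1.0; PROVED paper-level by locality,
kernel: routine from `evenBlock` depending on `w` only on `primeRange (2a)` + `GTablePrimes`): below
`a = ½ log n₁` every even block of the g-system equals `ζ`'s. (A `Prop`: statement only, label as stated above; not a Literature fact.) -/
def RecordIdentityBelow : Prop :=
  ∀ (m : ℕ → ℕ) (n₁ : ℕ) (win : Window), IsFirstDiscrepancy m n₁ → Real.exp (2 * win.a) < n₁ →
    datumOf (gTable m) win = zetaDatum win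

/-- THEOREM F1-A, integer layer (FAKES §1.1; PROVED paper-level, unconditional, via the continuum
statement `ZetaIsolationFin` + Galerkin density GAL-1; kernel OPEN): every integer g-prime system that
is a nonzero FINITE edit of the primes is detectably negative at some genuine window. (A `Prop`: statement only, label as stated above; not a Literature fact.) -/
def ZetaIsolationInt : Prop :=
  ∀ m : ℕ → ℕ, (∃ n₁, IsFirstDiscrepancy m n₁) → IsFiniteEdit m → DetectablyNegative (datumOf (gTable m))

/-- GAP F1-G-a = TIGHT ONSET (FAKES §1.4; CONJ; DATA for `n₁ ≤ 66` = `IntegerTwinCensus 66`): the first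
negative window comes before the next integer enters, `a < ½ log (n₁ + 1)` — no finiteness needed, by
locality only `m n₁` matters there. Carver's DELNEG-tight is the case `m n₁ = 0`, `n₁` prime. (A `Prop`: statement only, label as stated above; not a Literature fact.) -/
def TightOnset : Prop :=
  ∀ (m : ℕ → ℕ) (n₁ : ℕ), IsFirstDiscrepancy m n₁ →
    ∃ win : Window, win.a < Real.log (n₁ + 1) / 2 ∧ ¬ WindowPositive (datumOf (gTable m) win)

/-- INTEGER-TWIN CENSUS up to `M` (FAKES §1.2; DATA-certified for `M = 66` by fake-1 jobs j054049 /
j054053: one Arb-certified negative Rayleigh ball per `(n₁, sign)` at `N = 300`, `a* + 0.002 <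
½ log(n₁+1)`, plus LEMMA F1-M monotone legs `uᵀ A_{n₁} u > 0`; a kernel proof would be interval
arithmetic on `86` explicit matrices). [folklore] -/
def IntegerTwinCensus (M : ℕ) : Prop :=
  ∀ (m : ℕ → ℕ) (n₁ : ℕ), IsFirstDiscrepancy m n₁ → n₁ ≤ M →
    ∃ win : Window, win.a < Real.log (n₁ + 1) / 2 ∧ ¬ WindowPositive (datumOf (gTable m) win)

/-- LEMMA F1-M (monotone leg; PROVED paper-level, kernel: S): at a window seeing `n₁` but not `n₁+1`,
the block of `m` is `ζ`'s block minus `(m n₁ − primeIndicator n₁) •` the one-atom pattern at `log n₁`;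
hence one negative vector `u` for the single up-edit with `uᵀ A u ≥ 0` serves every `m n₁ ≥ 2`
(resp. `≥ 1` for composite `n₁`). Typed as the reduction it provides. (A `Prop`: statement only, label as stated above; not a Literature fact.) -/
def MonotoneLeg : Prop :=
  ∀ (m m' : ℕ → ℕ) (n₁ : ℕ) (win : Window), IsFirstDiscrepancy m n₁ → IsFirstDiscrepancy m' n₁ →
    Real.exp (2 * win.a) < n₁ + 1 → primeIndicator n₁ < m n₁ → m n₁ ≤ m' n₁ →
    (∃ u : Fin (win.N + 1) → ℝ, u ⬝ᵥ (datumOf (gTable m) win *ᵥ u) < 0 ∧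
        0 ≤ u ⬝ᵥ (primePattern n₁ win *ᵥ u)) →
    ¬ WindowPositive (datumOf (gTable m') win)

/-! ## §2 Real g-prime systems (sub-family B1) on the continuum layer -/

/-- The explicit-formula datum of a g-prime system with `ζ`'s dressing: g-primes `g i > 1` with
multiplicities `m i` (slot `i` unused when `m i = 0`); index `n ↦ (i, k) = n.unpair`, mass
`m_i log gᵢ · gᵢ^{-(k+1)/2}` at `± (k+1) log gᵢ`; smooth part = `ζ`'s (pole of order one kept —
honest only for `P = ℙ`, FAKES §1.0). [folklore] -/
def beurlingDatum (g : ℕ → ℝ) (m : ℕ → ℕ) : ExplicitDatum where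
  smooth := zetaC.smooth
  pos n := ((n.unpair.2 : ℝ) + 1) * Real.log (g n.unpair.1)
  wt n := (((m n.unpair.1 : ℝ) * Real.log (g n.unpair.1) *
      (g n.unpair.1) ^ (-(((n.unpair.2 : ℝ) + 1) / 2)) : ℝ) : ℂ)

/-- `F` is a NONZERO FINITE EVEN ATOMIC PERTURBATION of `ζ`'s datum: same smooth part, and prime terms
differing by `Σ_{(x,c) ∈ s} c (k(x) + k(−x))` on compactly supported `k`, with `s` a nonempty finite
set of (position `> 0`, real weight `≠ 0`) pairs with distinct positions. Covers every B2 integer edit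
and every finite dial / planted-on-the-line combination. [folklore] -/
def IsFiniteAtomicPerturbation (F : ExplicitDatum) : Prop :=
  F.smooth = zetaC.smooth ∧
  ∃ s : Finset (ℝ × ℝ), s.Nonempty ∧ (∀ p ∈ s, 0 < p.1 ∧ p.2 ≠ 0) ∧
    (∀ p ∈ s, ∀ q ∈ s, p.1 = q.1 → p = q) ∧
    ∀ k : ℝ → ℂ, HasCompactSupport k →
      F.primeTerm k = zetaC.primeTerm k + ∑ p ∈ s, (p.2 : ℂ) * (k p.1 + k (-p.1))

/-- THEOREM F1-A = ζ-ISOLATION AMONG FINITE PERTURBATIONS (FAKES §1.1; PROVED paper-level,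
UNCONDITIONAL; kernel OPEN — ingredients: Bochner–Schwartz for positive-definite tempered
distributions, the explicit formula (tree `weil_criterion_holds` side), 'a one-signed Bohr-almost-periodic
function of mean zero vanishes', Landau's lemma for Laplace transforms of non-negative functions):
no nonzero finite atomic perturbation of `ζ`'s datum is Weil-positive at all windows. Consequently on
`𝒞_fin(ζ)` all-window positivity is `ζ`-SPECIFIC and RH-STRENGTH: `F.Positivity → F = ζ-datum ∧ RH`. (A `Prop`: statement only, label as stated above; not a Literature fact.) -/
def ZetaIsolationFin : Prop :=
  ∀ F : ExplicitDatum, IsFiniteAtomicPerturbation F → ¬ F.Positivity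

/-- THEOREM F1-A′ (FAKES §1.1; PROVED paper-level UNDER RH only — the ¬RH branch needs perturbation-blind
tests, unavailable for infinite perturbations): an absolutely summable even atomic perturbation with all
positions `> 0` (e.g. Broucke–Debruyne–Révész `𝒫_β = ℙ ∪ ℙ^{1/β}`, `β < ½`, arXiv:2309.01567 §5) is not
Weil-positive. Typed with the summable family indexed by `ℕ`. (Reference: arXiv:2309.01567, §5; a `Prop`:
statement only; not a Literature fact.) -/
def ZetaIsolationSummableRH : Prop :=
  RiemannHypothesis →
  ∀ (F : ExplicitDatum) (x c : ℕ → ℝ), F.smooth = zetaC.smooth → Summable (fun j => |c j|) →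
    (∃ j, c j ≠ 0) → (∀ j, 0 < x j) → Function.Injective x →
    (∀ k : ℝ → ℂ, HasCompactSupport k → Continuous k →
      F.primeTerm k = zetaC.primeTerm k + ∑' j, (c j : ℂ) * (k (x j) + k (-(x j)))) →
    ¬ F.Positivity

/-- GAP F1-G-b = BEURLING RIGIDITY off `𝒞_fin` (FAKES §1.4; OPEN — a Hamburger / Fourier-quasicrystal-type
rigidity question, explicitly NOT an RH-type statement): no g-prime system other than the primes, dressed as
`ζ`, is Weil-positive at all windows. `g` injective with values `> 1`, not a re-indexing of the primes. (A `Prop`: statement only, label as stated above; not a Literature fact.) -/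
def BeurlingRigidity : Prop :=
  ∀ (g : ℕ → ℝ) (m : ℕ → ℕ), (∀ i, 1 < g i) → Function.Injective g →
    (¬ ∀ k : ℝ → ℂ, HasCompactSupport k → (beurlingDatum g m).primeTerm k = zetaC.primeTerm k) →
    ¬ (beurlingDatum g m).Positivity

/-! ## §3 Trivial structural lemmas (PROVED) -/

/-- The census is monotone in the cutoff. [folklore] -/
theorem integerTwinCensus_mono {M M' : ℕ} (h : M ≤ M') (hc : IntegerTwinCensus M') :
    IntegerTwinCensus M := fun m n₁ hd hn => hc m n₁ hd (hn.trans h)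

/-- Tight onset is the census at every cutoff. [folklore] -/
theorem tightOnset_iff_forall_census : TightOnset ↔ ∀ M, IntegerTwinCensus M :=
  ⟨fun h _M m n₁ hd _ => h m n₁ hd, fun h m n₁ hd => h n₁ m n₁ hd le_rfl⟩

/-- Tight onset gives detectable negativity for every non-prime integer system with a first discrepancy
(no finiteness needed). [folklore] -/
theorem detectablyNegative_of_tightOnset (h : TightOnset) {m : ℕ → ℕ} {n₁ : ℕ}
    (hd : IsFirstDiscrepancy m n₁) : DetectablyNegative (datumOf (gTable m)) := by
  obtain ⟨win, -, hneg⟩ := h m n₁ hd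
  rw [detectablyNegative_iff_not_allWindowsPositive]
  exact fun hall => hneg (hall win)


/-! ## §4 The PARITY RULE (FAKES §1.2b): which sector sees an edit first -/

/-- LEMMA F1-P = EDGE-SLIVER SIGN LEMMA (FAKES §1.2b; PROVED paper-level, elementary; kernel: S).
For a continuous test function `g` supported in `[-a, a]`, of parity `ε`, one-signed on the edge sliver
`[x - a, a]` (`0 < x < 2a`), the autocorrelation `(g ⋆ g̃)(x) = ∫ g y · g (y - x) dy` — the coefficient with
which an atom at position `x` enters the Weil form — has the sign `ε`: only `y ∈ [x - a, a]` contributes,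
there `g (y - x) = ε · g (x - y)` with `x - y` again in the sliver, so `ε · (g ⋆ g̃)(x) = ∫_{sliver} g y · g (x - y) dy ≥ 0`.
Consequence (with `lambdapertDatum_quadratic`-type sign conventions: `Q_P = Q_ζ − Δm · w · (g ⋆ g̃)(log n)`):
an UP-edit lowers the form on edge-one-signed EVEN functions and raises it on ODD ones; a DOWN-edit the
reverse.  PREDICTION (DATA, not a theorem: it presumes the extremal witness is edge-one-signed — the edge
law): first detection is EVEN for up-edits, ODD for deletions. (A `Prop`: statement only, label as stated above; not a Literature fact.) -/
def AutocorrParitySign : Prop :=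
  ∀ (g : ℝ → ℝ) (a x ε : ℝ), Continuous g → 0 < x → x < 2 * a → (ε = 1 ∨ ε = -1) →
    (∀ y, g (-y) = ε * g y) → (∀ y, a < |y| → g y = 0) → (∀ y ∈ Set.Icc (x - a) a, 0 ≤ g y) →
    0 ≤ ε * ∫ y, g y * g (y - x)

/-- LEMMA F1-P holds (kernel proof; elementary: the integrand `g y · g (x - y)` is pointwise `≥ 0`). [folklore] -/
theorem autocorrParitySign : AutocorrParitySign := by
  intro g a x ε _hg _hx _hxa hε hpar hsupp hpos
  have hε2 : ε * ε = 1 := by rcases hε with h | h <;> subst h <;> norm_num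
  have key : ∀ y, ε * (g y * g (y - x)) = g y * g (x - y) := by
    intro y
    have h1 : g (y - x) = ε * g (x - y) := by
      have := hpar (x - y); rwa [show -(x - y) = y - x by ring] at this
    rw [h1]
    calc ε * (g y * (ε * g (x - y))) = (ε * ε) * (g y * g (x - y)) := by ring
      _ = g y * g (x - y) := by rw [hε2, one_mul]
  rw [← MeasureTheory.integral_const_mul]
  simp_rw [key]
  apply MeasureTheory.integral_nonneg
  intro y
  by_cases h1 : a < |y|
  · simp [hsupp y h1]
  by_cases h2 : a < |x - y|
  · simp [hsupp (x - y) h2]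
  push Not at h1 h2
  have hy : y ∈ Set.Icc (x - a) a :=
    ⟨by have := (abs_le.mp h2).2; linarith, (abs_le.mp h1).2⟩
  have hxy : x - y ∈ Set.Icc (x - a) a :=
    ⟨by have := (abs_le.mp h1).2; linarith, (abs_le.mp h2).2⟩
  exact mul_nonneg (hpos y hy) (hpos (x - y) hxy)

/-- `ζ`'s own datum is not a finite atomic perturbation of itself with a NONEMPTY perturbation set only if the
prime terms differ; recorded: the perturbation class excludes `F` with `F.primeTerm = ζ.primeTerm` on
compactly supported tests whenever the atoms are linearly independent — not proved here (needs test functions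
separating finitely many points; kernel: S). -/
def PerturbationNonDegenerate : Prop :=
  ∀ F, IsFiniteAtomicPerturbation F → ∃ k : ℝ → ℂ, HasCompactSupport k ∧ F.primeTerm k ≠ zetaC.primeTerm k

end Summit.RiemannHypothesis.RiemannHypothesis.Theorems.PfPersistence.Fake1
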